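import Summits.KontsevichZagierPeriods.Zeta5Search.TwoTaleP15SecondTaleBZones

/-!
# The two-tale point P15: Lemma 8 for `B_k` and `p̂` — part 3 (zone β₂, assembly, bridge)

HONEST FRAMING: systematic search; no irrationality claim unless certified.

Cell pub-zeta5, T3 service [Zudilin2014ZetaTwo, Section 6, Lemma 8].  At the partner of P15:
* **zone β₂** (`16n+1 ≤ k ≤ 24n+1`, `26n < p²`): `B_k = A_k·(numT′/numT − dhatT′/dhatT)(−k)`, `‖A_k‖_p ≤ p^{−E(k)}`
  (Kummer) and every logarithmic term has norm `≤ p`, so `‖B_k‖_p ≤ p^{1−E(k)}`; `padicNorm_coefBT_le` on the whole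
  range `13n+1 ≤ k ≤ 26n+1`;
* **`padicNorm_formPT_le`** — Lemma 8 for `p̂`: `‖p̂_n‖_p ≤ p^{2−e}` whenever `e ≤ E(k)` for all `13n+1 ≤ k ≤ 26n+1`;
* **`dvd_pP15num_of_bmiss`** — with `p_n = −p̂_n` ((bmiss)@P15, an INPUT) and `p ≤ 15n`: `p^e ∣ D₁₅ₙD₁₆ₙ p_n`.
The interval theorems (decision trees for `E(k) ≥ level`) are in `TwoTaleP15SecondTaleBCellsA/B`.
-/

noncomputable section

namespace Summit.KontsevichZagierPeriods.Zeta5Search.TwoTaleP15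

open Finset Polynomial
open Literature.NumberTheory.Irrationality.Zudilin2014
open Literature.NumberTheory.DiophantineApproximation (RhinViola.padicValNat_factorial_of_lt_sq)
open Literature.NumberTheory.Transcendental (OddZeta.dvd_lcmUpto)
section ZoneB2

variable {n : ℕ} {p : ℕ} [hp : Fact p.Prime]

/-- `‖A_k‖_p ≤ p^{−E(k)}` on `16n+1 ≤ k ≤ 24n+1` (Kummer's first carry, `pow_dvd_coefATZ`). -/
theorem padicNorm_coefAT_le (hn : 1 ≤ n) {k : ℤ} (h1 : 16 * (n : ℤ) + 1 ≤ k) (h2 : k ≤ 24 * (n : ℤ) + 1) :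
    padicNorm p (coefAT (aT n) (bT n) k) ≤ (p : ℚ) ^ (-EZ p n k) := by
  have hD2 : k ∈ Ico (aT n 2) (bT n 2) := by simp [mem_Ico]; omega
  have hD3 : k ∈ Ico (aT n 3) (bT n 3) := by simp [mem_Ico]; omega
  rw [coefAT_eq_cast (admissibleT hn) hD2 hD3 (by simp; omega) (by simp; omega), EZ_eq_digitAT h1 h2]
  have hd := pow_dvd_coefATZ (p := p) hD2 hD3 (by simp; omega) (by simp; omega) (by simp; omega)
  have hd' : ((p ^ digitAT p (aT n) (bT n) k : ℕ) : ℤ) ∣ coefATZ (aT n) (bT n) k := by exact_mod_cast hd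
  exact (padicNorm.dvd_iff_norm_le (p := p)).1 hd'

omit hp in
/-- `p^m ∤ d` for a nonzero integer with `|d| < p^m`. -/
theorem not_pow_dvd_of_natAbs_lt {d : ℤ} (hd : d ≠ 0) {m : ℕ} (hlt : d.natAbs < p ^ m) : ¬ (p : ℤ) ^ m ∣ d := by
  intro hdvd
  have : p ^ m ≤ d.natAbs := Nat.le_of_dvd (Int.natAbs_pos.2 hd) (by
    have := Int.natAbs_dvd_natAbs.2 hdvd; simpa using this)
  omega

/-- `‖1/d‖_p ≤ p^j` for a nonzero integer `d` with `p^{j+1} ∤ d`. -/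
theorem padicNorm_inv_int_le_pow {d : ℤ} (hd : d ≠ 0) {j : ℕ} (hnd : ¬ (p : ℤ) ^ (j + 1) ∣ d) :
    padicNorm p (1 / (d : ℚ)) ≤ (p : ℚ) ^ (j : ℤ) := by
  have hp1 : 1 < p := hp.out.one_lt
  have hv : padicValInt p d ≤ j := by
    by_contra h
    push Not at h
    exact hnd ((padicValInt_dvd_iff (j + 1) d).2 (Or.inr (by omega)))
  have hd' : (d : ℚ) ≠ 0 := by exact_mod_cast hd
  rw [one_div, padicNorm.eq_zpow_of_nonzero (inv_ne_zero hd'), padicValRat.inv, padicValRat.of_int, neg_neg]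
  exact zpow_le_zpow_right₀ (by exact_mod_cast hp1.le) (by exact_mod_cast hv)

/-- A sum of terms `c/d_i` with `‖c‖_p ≤ 1` and nonzero integers `d_i`, none divisible by `p^{j+1}`, has norm `≤ p^j`. -/
theorem padicNorm_sum_inv_le_pow {s : Finset ℤ} (c : ℚ) (hc : padicNorm p c ≤ 1) (d : ℤ → ℤ) (j : ℕ)
    (hd : ∀ i ∈ s, d i ≠ 0 ∧ ¬ (p : ℤ) ^ (j + 1) ∣ d i) :
    padicNorm p (∑ i ∈ s, c / ((d i : ℤ) : ℚ)) ≤ (p : ℚ) ^ (j : ℤ) := by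
  refine padicNorm.sum_le' (fun i hi => ?_) (by positivity)
  rw [div_eq_mul_one_div, padicNorm.mul]
  calc padicNorm p c * padicNorm p (1 / ((d i : ℤ) : ℚ)) ≤ 1 * (p : ℚ) ^ (j : ℤ) :=
        mul_le_mul hc (padicNorm_inv_int_le_pow (hd i hi).1 (hd i hi).2) (padicNorm.nonneg _) zero_le_one
    _ = _ := one_mul _

/-- **Kummer with two carries**: if besides the first carry there is a carry out of the second digit
(`p² ≤ m mod p² + (M−m) mod p²`), then `p^{⌊M/p⌋−⌊m/p⌋−⌊(M−m)/p⌋+1} ∣ binom(M,m)`. -/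
theorem succ_firstDigit_le_padicValNat_choose {M m : ℕ} (h : m ≤ M)
    (h2 : p ^ 2 ≤ m % p ^ 2 + (M - m) % p ^ 2) :
    M / p - m / p - (M - m) / p + 1 ≤ padicValNat p (M.choose m) := by
  have hp0 : 0 < p := hp.out.pos
  rw [padicValNat_choose (p := p) h (Nat.lt_succ_self (Nat.log p M))]
  have hlog : 2 ≤ Nat.log p M := by
    apply Nat.le_log_of_pow_le hp.out.one_lt
    have : m % p ^ 2 ≤ m := Nat.mod_le _ _; have : (M - m) % p ^ 2 ≤ M - m := Nat.mod_le _ _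
    omega
  have hsplit : M / p = m / p + (M - m) / p + if p ≤ m % p + (M - m) % p then 1 else 0 := by
    conv_lhs => rw [← Nat.add_sub_cancel' h]
    exact Nat.add_div hp0
  have h2mem : 2 ∈ {i ∈ Finset.Ico 1 (Nat.log p M + 1) | p ^ i ≤ m % p ^ i + (M - m) % p ^ i} := by
    simp only [Finset.mem_filter, Finset.mem_Ico]
    exact ⟨⟨by norm_num, by omega⟩, h2⟩
  by_cases hc : p ≤ m % p + (M - m) % p
  · rw [if_pos hc] at hsplit
    have h1 : M / p - m / p - (M - m) / p + 1 = ({1, 2} : Finset ℕ).card := by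
      rw [Finset.card_insert_of_notMem (by simp), Finset.card_singleton]; omega
    rw [h1]
    refine Finset.card_le_card fun i hi => ?_
    simp only [Finset.mem_insert, Finset.mem_singleton] at hi
    rcases hi with rfl | rfl
    · simp only [Finset.mem_filter, Finset.mem_Ico, le_refl, true_and, pow_one]
      exact ⟨by omega, hc⟩
    · exact h2mem
  · rw [if_neg hc] at hsplit
    have h0 : M / p - m / p - (M - m) / p + 1 = 1 := by omega
    rw [h0]
    exact Nat.one_le_iff_ne_zero.2 (Finset.card_ne_zero.2 ⟨2, h2mem⟩)

/-- `A_k` with the extra carry: if some factor `ℓ − 2k` of the doubled block is divisible by `p²`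
(possible only when `p² ≤ 33n`), then `p^{digitAT + 1} ∣ A_k` (generic second-tale parameters). -/
theorem pow_succ_dvd_coefATZ {a b : Fin 4 → ℤ} {k : ℤ}
    (h2 : k ∈ Ico (a 2) (b 2)) (h3 : k ∈ Ico (a 3) (b 3)) (hk1 : a 1 ≤ k) (hb0 : b 0 ≤ a 0) (hb1 : b 1 ≤ a 1)
    (hcarry : p ^ 2 ≤ (a 0 - b 0).toNat % p ^ 2 + (2 * k - a 0).toNat % p ^ 2) :
    (p : ℤ) ^ (digitAT p a b k + 1) ∣ coefATZ a b k := by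
  have hk2 := mem_Ico.1 h2
  have hk3 := mem_Ico.1 h3
  unfold coefATZ
  split_ifs with hz
  · exact dvd_zero _
  · push Not at hz
    unfold digitAT
    have e0 : (2 * k - b 0).toNat - (a 0 - b 0).toNat = (2 * k - a 0).toNat := by omega
    have d0nat := succ_firstDigit_le_padicValNat_choose (p := p)
      (show (a 0 - b 0).toNat ≤ (2 * k - b 0).toNat by omega) (by rw [e0]; exact hcarry)
    rw [e0] at d0nat
    have d0 : (p : ℤ) ^ ((2 * k - b 0).toNat / p - (a 0 - b 0).toNat / p - (2 * k - a 0).toNat / p + 1)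
        ∣ (Nat.choose (2 * k - b 0).toNat (a 0 - b 0).toNat : ℤ) := by
      have h1 : p ^ ((2 * k - b 0).toNat / p - (a 0 - b 0).toNat / p - (2 * k - a 0).toNat / p + 1)
          ∣ Nat.choose (2 * k - b 0).toNat (a 0 - b 0).toNat :=
        (pow_dvd_pow p d0nat).trans pow_padicValNat_dvd
      exact_mod_cast h1
    have d1 := pow_firstDigit_dvd_choose (p := p) (show (a 1 - b 1).toNat ≤ (k - b 1).toNat by omega)
    have d2 := pow_firstDigit_dvd_choose (p := p) (show (k - a 2).toNat ≤ (b 2 - a 2 - 1).toNat by omega)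
    have d3 := pow_firstDigit_dvd_choose (p := p) (show (k - a 3).toNat ≤ (b 3 - a 3 - 1).toNat by omega)
    have e1 : (k - b 1).toNat - (a 1 - b 1).toNat = (k - a 1).toNat := by omega
    have e2 : (b 2 - a 2 - 1).toNat - (k - a 2).toNat = (b 2 - 1 - k).toNat := by omega
    have e3 : (b 3 - a 3 - 1).toNat - (k - a 3).toNat = (b 3 - 1 - k).toNat := by omega
    rw [e1] at d1; rw [e2] at d2; rw [e3] at d3
    rw [show (2 * k - b 0).toNat / p - (a 0 - b 0).toNat / p - (2 * k - a 0).toNat / p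
        + ((k - b 1).toNat / p - (a 1 - b 1).toNat / p - (k - a 1).toNat / p)
        + ((b 2 - a 2 - 1).toNat / p - (k - a 2).toNat / p - (b 2 - 1 - k).toNat / p)
        + ((b 3 - a 3 - 1).toNat / p - (k - a 3).toNat / p - (b 3 - 1 - k).toNat / p) + 1
        = ((2 * k - b 0).toNat / p - (a 0 - b 0).toNat / p - (2 * k - a 0).toNat / p + 1)
        + ((k - b 1).toNat / p - (a 1 - b 1).toNat / p - (k - a 1).toNat / p)
        + ((b 2 - a 2 - 1).toNat / p - (k - a 2).toNat / p - (b 2 - 1 - k).toNat / p)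
        + ((b 3 - a 3 - 1).toNat / p - (k - a 3).toNat / p - (b 3 - 1 - k).toNat / p) by omega,
      pow_add, pow_add, pow_add]
    have h := mul_dvd_mul (mul_dvd_mul (mul_dvd_mul d0 d1) d2) d3
    exact h.trans (Dvd.intro_left ((-1 : ℤ) ^ ((a 0 - b 0).toNat + (a 1 - b 1).toNat + (k - a 2).toNat
      + (k - a 3).toNat)) (by ring))

/-- `‖A_k‖_p ≤ p^{−E(k)−1}` on `16n+1 ≤ k ≤ 24n+1` when some `ℓ − 2k` (`15n+2 ≤ ℓ < 32n+2`) is divisible by `p²`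
(`26n < p²`: then `ℓ − 2k = −p²` and the binomial `binom(2k−15n−2, 17n)` carries out of its second digit). -/
theorem padicNorm_coefAT_le_succ (hn : 1 ≤ n) (hp2 : 26 * n < p ^ 2) {k : ℤ} (h1 : 16 * (n : ℤ) + 1 ≤ k)
    (h2 : k ≤ 24 * (n : ℤ) + 1) (hbad : ∃ l ∈ Ico (bT n 0) (aT n 0), (p : ℤ) ^ 2 ∣ l - 2 * k) :
    padicNorm p (coefAT (aT n) (bT n) k) ≤ (p : ℚ) ^ (-EZ p n k - 1) := by
  have hD2 : k ∈ Ico (aT n 2) (bT n 2) := by simp [mem_Ico]; omega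
  have hD3 : k ∈ Ico (aT n 3) (bT n 3) := by simp [mem_Ico]; omega
  obtain ⟨l, hl, hdvd⟩ := hbad
  simp only [mem_Ico, aT_zero, bT_zero] at hl
  -- ℓ − 2k = −p²·c forces 2k − ℓ = p² (0 < 2k − ℓ ≤ 33n < 2p²)
  obtain ⟨c, hc⟩ := hdvd
  have hp2z : (26 : ℤ) * n < (p : ℤ) ^ 2 := by exact_mod_cast hp2
  have hc1 : c = -1 := by
    rcases lt_trichotomy c (-1) with h | h | h
    · nlinarith
    · exact h
    · rcases lt_or_ge c 1 with h' | h'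
      · have : c = 0 := by omega
        subst this; omega
      · nlinarith
  subst hc1
  have hcarry : p ^ 2 ≤ (aT n 0 - bT n 0).toNat % p ^ 2 + (2 * k - aT n 0).toNat % p ^ 2 := by
    simp only [aT_zero, bT_zero]
    have e17 : (32 * (n : ℤ) + 2 - (15 * n + 2)).toNat = 17 * n := by
      rw [show (32 * (n : ℤ) + 2 - (15 * n + 2)) = ((17 * n : ℕ) : ℤ) by push_cast; ring, Int.toNat_natCast]
    rw [e17, Nat.mod_eq_of_lt (by omega)]
    -- (2k − 32n − 2) = p² − (32n + 2 − ℓ)·… : write 2k − â₀ = p² + (ℓ − â₀) with −17n ≤ ℓ − â₀ < 0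
    have hx : (2 * k - (32 * (n : ℤ) + 2)).toNat = p ^ 2 - (32 * n + 2 - l).toNat := by
      have : (2 * k - (32 * (n : ℤ) + 2)) = ((p ^ 2 : ℕ) : ℤ) - (32 * n + 2 - l) := by push_cast; linarith
      omega
    rw [hx]
    have hlt : (32 * (n : ℤ) + 2 - l).toNat ≤ 17 * n := by omega
    have hpos : 0 < (32 * (n : ℤ) + 2 - l).toNat := by omega
    rw [Nat.mod_eq_of_lt (by omega)]
    omega
  rw [coefAT_eq_cast (admissibleT hn) hD2 hD3 (by simp; omega) (by simp; omega)]
  have hd := pow_succ_dvd_coefATZ (p := p) hD2 hD3 (by simp; omega) (by simp; omega) (by simp; omega) hcarry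
  have hd' : ((p ^ (digitAT p (aT n) (bT n) k + 1) : ℕ) : ℤ) ∣ coefATZ (aT n) (bT n) k := by exact_mod_cast hd
  have := (padicNorm.dvd_iff_norm_le (p := p)).1 hd'
  refine this.trans (le_of_eq ?_)
  rw [EZ_eq_digitAT h1 h2]; push_cast; ring_nf

/-- **Zone β₂** (`16n+1 ≤ k ≤ 24n+1`, `26n < p²`): `‖B_k‖_p ≤ p^{1−E(k)}` — logarithmic derivative at a generic double
pole.  When no factor `ℓ − 2k` of the doubled block is divisible by `p²` every logarithmic term has norm `≤ p`;
otherwise (only possible for `p² ≤ 33n`) that one term has norm `p²` but `A_k` carries an extra `p`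
(`padicNorm_coefAT_le_succ`). -/
theorem padicNorm_coefBT_zoneB2 (hn : 1 ≤ n) (hp2 : 26 * n < p ^ 2) {k : ℤ} (h1 : 16 * (n : ℤ) + 1 ≤ k)
    (h2 : k ≤ 24 * (n : ℤ) + 1) :
    padicNorm p (coefBT (aT n) (bT n) k) ≤ (p : ℚ) ^ (1 - EZ p n k) := by
  have hp0 : (p : ℚ) ≠ 0 := by exact_mod_cast hp.out.ne_zero
  have hD2 : k ∈ Ico (aT n 2) (bT n 2) := by simp [mem_Ico]; omega
  have hD3 : k ∈ Ico (aT n 3) (bT n 3) := by simp [mem_Ico]; omega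
  have hm : multT (aT n) (bT n) k = 2 := (multT_partner k).2.1 (by omega) h2
  have hB0 : ∀ l ∈ Ico (bT n 0) (aT n 0), l ≠ 2 * k := fun l hl => by simp [mem_Ico] at hl; omega
  have hB1 : ∀ i ∈ Ico (bT n 1) (aT n 1), i ≠ k := fun i hi => by simp [mem_Ico] at hi; omega
  have hnum : (numT (aT n) (bT n)).eval (-(k : ℚ)) ≠ 0 := by
    rw [eval_numT_partner]
    refine mul_ne_zero (mul_ne_zero ?_ (prod_ne_zero_iff.2 fun l hl h => hB0 l hl ?_))
      (prod_ne_zero_iff.2 fun i hi h => hB1 i hi ?_)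
    · unfold normT facZ; positivity
    · have : ((l : ℤ) : ℚ) = ((2 * k : ℤ) : ℚ) := by linarith
      exact_mod_cast this
    · have : ((i : ℤ) : ℚ) = ((k : ℤ) : ℚ) := by linarith
      exact_mod_cast this
  have hden := eval_dhatT_ne_zero hD2 hD3
  -- the carry exponent j: 1 generically, 2 when a factor ℓ − 2k is divisible by p² (then A_k gains a p)
  obtain ⟨j, hj, hA, hBj⟩ : ∃ j : ℕ, 1 ≤ j ∧
      padicNorm p (coefAT (aT n) (bT n) k) ≤ (p : ℚ) ^ (-EZ p n k - ((j - 1 : ℕ) : ℤ)) ∧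
      ∀ l ∈ Ico (bT n 0) (aT n 0), ¬ (p : ℤ) ^ (j + 1) ∣ l - 2 * k := by
    by_cases hbad : ∃ l ∈ Ico (bT n 0) (aT n 0), (p : ℤ) ^ 2 ∣ l - 2 * k
    · refine ⟨2, by norm_num, ?_, fun l hl => not_pow_dvd_of_natAbs_lt (p := p) ?_ ?_⟩
      · have := padicNorm_coefAT_le_succ hn hp2 h1 h2 hbad
        simpa using this
      · simp [mem_Ico] at hl; omega
      · simp [mem_Ico] at hl
        have h3 : 2 * p ^ 2 ≤ p ^ (2 + 1) :=
          calc 2 * p ^ 2 = p ^ 2 * 2 := mul_comm _ _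
            _ ≤ p ^ 2 * p := Nat.mul_le_mul_left _ hp.out.two_le
            _ = p ^ (2 + 1) := (pow_succ p 2).symm
        omega
    · refine ⟨1, le_refl _, by simpa using padicNorm_coefAT_le hn h1 h2, fun l hl hdvd => hbad ⟨l, hl, ?_⟩⟩
      simpa using hdvd
  rw [coefBT_of_double hm hnum hden, eval_derivative_numT_eq hB0 hB1, eval_derivative_dhatT_eq,
    mul_div_cancel_left₀ _ hnum, mul_div_cancel_left₀ _ hden, padicNorm.mul,
    show (1 : ℤ) - EZ p n k = (-EZ p n k - ((j - 1 : ℕ) : ℤ)) + (j : ℤ) by push_cast [Nat.cast_sub hj]; ring,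
    zpow_add₀ hp0]
  refine mul_le_mul hA ?_ (padicNorm.nonneg _) (by positivity)
  -- the four logarithmic sums, each of norm ≤ p^j
  have hpj : p ^ 2 ≤ p ^ (j + 1) := Nat.pow_le_pow_right hp.out.pos (by omega)
  have two_le : padicNorm p (2 : ℚ) ≤ 1 := by have := padicNorm.of_int (p := p) 2; simpa using this
  have one_le : padicNorm p (1 : ℚ) ≤ 1 := by simp
  have hS0 : padicNorm p (∑ l ∈ Ico (bT n 0) (aT n 0), 2 / ((l : ℚ) - 2 * k)) ≤ (p : ℚ) ^ (j : ℤ) := by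
    have := padicNorm_sum_inv_le_pow (p := p) (s := Ico (bT n 0) (aT n 0)) 2 two_le (fun l => l - 2 * k) j
      (fun l hl => ⟨by simp [mem_Ico] at hl; omega, hBj l hl⟩)
    refine le_of_eq_of_le ?_ this
    congr 1; exact sum_congr rfl fun l _ => by push_cast; ring
  have hS1 : padicNorm p (∑ i ∈ Ico (bT n 1) (aT n 1), 1 / ((i : ℚ) - k)) ≤ (p : ℚ) ^ (j : ℤ) := by
    have := padicNorm_sum_inv_le_pow (p := p) (s := Ico (bT n 1) (aT n 1)) 1 one_le (fun i => i - k) j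
      (fun i hi => by
        simp [mem_Ico] at hi
        exact ⟨by omega, not_pow_dvd_of_natAbs_lt (p := p) (by omega) (lt_of_lt_of_le (by omega) hpj)⟩)
    refine le_of_eq_of_le ?_ this
    congr 1; exact sum_congr rfl fun i _ => by push_cast; ring
  have hS2 : padicNorm p (∑ i ∈ (Ico (aT n 2) (bT n 2)).erase k, 1 / ((i : ℚ) - k)) ≤ (p : ℚ) ^ (j : ℤ) := by
    have := padicNorm_sum_inv_le_pow (p := p) (s := (Ico (aT n 2) (bT n 2)).erase k) 1 one_le (fun i => i - k) j
      (fun i hi => by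
        have hik := ne_of_mem_erase hi; have hi' := mem_of_mem_erase hi
        simp [mem_Ico] at hi'
        exact ⟨by omega, not_pow_dvd_of_natAbs_lt (p := p) (by omega) (lt_of_lt_of_le (by omega) hpj)⟩)
    refine le_of_eq_of_le ?_ this
    congr 1; exact sum_congr rfl fun i _ => by push_cast; ring
  have hS3 : padicNorm p (∑ i ∈ (Ico (aT n 3) (bT n 3)).erase k, 1 / ((i : ℚ) - k)) ≤ (p : ℚ) ^ (j : ℤ) := by
    have := padicNorm_sum_inv_le_pow (p := p) (s := (Ico (aT n 3) (bT n 3)).erase k) 1 one_le (fun i => i - k) j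
      (fun i hi => by
        have hik := ne_of_mem_erase hi; have hi' := mem_of_mem_erase hi
        simp [mem_Ico] at hi'
        exact ⟨by omega, not_pow_dvd_of_natAbs_lt (p := p) (by omega) (lt_of_lt_of_le (by omega) hpj)⟩)
    refine le_of_eq_of_le ?_ this
    congr 1; exact sum_congr rfl fun i _ => by push_cast; ring
  rw [sub_eq_add_neg]
  calc padicNorm p (∑ l ∈ Ico (bT n 0) (aT n 0), 2 / ((l : ℚ) - 2 * k) + ∑ i ∈ Ico (bT n 1) (aT n 1), 1 / ((i : ℚ) - k)
        + -(∑ i ∈ (Ico (aT n 2) (bT n 2)).erase k, 1 / ((i : ℚ) - k)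
          + ∑ i ∈ (Ico (aT n 3) (bT n 3)).erase k, 1 / ((i : ℚ) - k)))
      ≤ max (padicNorm p (∑ l ∈ Ico (bT n 0) (aT n 0), 2 / ((l : ℚ) - 2 * k)
          + ∑ i ∈ Ico (bT n 1) (aT n 1), 1 / ((i : ℚ) - k)))
        (padicNorm p (-(∑ i ∈ (Ico (aT n 2) (bT n 2)).erase k, 1 / ((i : ℚ) - k)
          + ∑ i ∈ (Ico (aT n 3) (bT n 3)).erase k, 1 / ((i : ℚ) - k)))) := padicNorm.nonarchimedean
    _ ≤ (p : ℚ) ^ (j : ℤ) := by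
        refine max_le ((padicNorm.nonarchimedean).trans (max_le hS0 hS1)) ?_
        rw [padicNorm.neg]
        exact (padicNorm.nonarchimedean).trans (max_le hS2 hS3)

/-- **`‖B_k‖_p ≤ p^{1−E(k)}` on the whole `p̂`-range `13n+1 ≤ k ≤ 26n+1`** (`26n < p²`). -/
theorem padicNorm_coefBT_le (hn : 1 ≤ n) (hp2 : 26 * n < p ^ 2) {k : ℤ} (h1 : 13 * (n : ℤ) + 1 ≤ k)
    (h2 : k ≤ 26 * (n : ℤ) + 1) :
    padicNorm p (coefBT (aT n) (bT n) k) ≤ (p : ℚ) ^ (1 - EZ p n k) := by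
  rcases le_or_gt k (15 * (n : ℤ)) with hk | hk
  · rw [coefBT_zoneA h1 hk]; simp only [padicNorm.zero]; positivity
  rcases le_or_gt k (16 * (n : ℤ)) with hk' | hk'
  · exact padicNorm_coefBT_zoneB1 hp2 (by omega) hk'
  rcases le_or_gt k (24 * (n : ℤ) + 1) with hk'' | hk''
  · exact padicNorm_coefBT_zoneB2 hn hp2 (by omega) hk''
  · exact padicNorm_coefBT_zoneG hp2 (by omega) h2

end ZoneB2

/-! ### Lemma 8 for `p̂` at the partner -/

section Assembly

variable {n : ℕ} {p : ℕ} [hp : Fact p.Prime]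

/-- The index data of `p̂` at the partner: `â₂* = 13n+1`, `b̂₃* = 26n+2`, `â₀* = 26n+2`. -/
theorem rangeB_eq (n : ℕ) :
    aMid (aT n) = 13 * (n : ℤ) + 1 ∧ bMax (bT n) = 26 * (n : ℤ) + 2 ∧ a0star (aT n) = 26 * (n : ℤ) + 2 := by
  have h1 : aMid (aT n) = 13 * (n : ℤ) + 1 := by unfold aMid; simp; omega
  refine ⟨h1, ?_, ?_⟩
  · unfold bMax; simp; omega
  · unfold a0star; rw [h1]; simp; omega

/-- **Zudilin 2014, Lemma 8 for `p̂` at the partner of P15** (kernel): if `e ≤ E(k)` for every `13n+1 ≤ k ≤ 26n+1`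
and `26n < p²`, then `‖p̂_n‖_p ≤ p^{2−e}` (`ord_p p̂ ≥ φ̂ − 2`). -/
theorem padicNorm_formPT_le (hn : 1 ≤ n) (hp2 : 26 * n < p ^ 2) {e : ℤ}
    (he : ∀ k : ℤ, 13 * (n : ℤ) + 1 ≤ k → k ≤ 26 * (n : ℤ) + 1 → e ≤ EZ p n k) :
    padicNorm p (formPT (aT n) (bT n)) ≤ (p : ℚ) ^ (2 - e) := by
  have hp0 : (p : ℚ) ≠ 0 := by exact_mod_cast hp.out.ne_zero
  have hp1 : (1 : ℚ) ≤ p := by exact_mod_cast hp.out.one_lt.le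
  obtain ⟨hA3, hB2⟩ := range_eq n
  obtain ⟨hMid, hMax, h0s⟩ := rangeB_eq n
  have hsign : padicNorm p (signT (bT n)) = 1 := by
    unfold signT; rcases neg_one_pow_eq_or ℚ (bT n 2 + bT n 3).natAbs with h | h <;> rw [h] <;> simp
  unfold formPT
  rw [padicNorm.mul, hsign, one_mul, hA3, hB2, hMid, hMax, h0s]
  have two_le : padicNorm p (2 : ℚ) ≤ 1 := by have := padicNorm.of_int (p := p) 2; simpa using this
  -- the A-part
  have hA : ∀ k ∈ Ico (15 * (n : ℤ) + 1) (24 * (n : ℤ) + 2),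
      padicNorm p (2 * coefAT (aT n) (bT n) k * harmAlt2 (2 * k - (26 * (n : ℤ) + 2)).toNat) ≤ (p : ℚ) ^ (2 - e) := by
    intro k hk
    rw [mem_Ico] at hk
    rcases le_or_gt k (16 * (n : ℤ)) with hk16 | hk16
    · rw [coefAT_zoneB1 hk.1 hk16]; simp only [mul_zero, zero_mul, padicNorm.zero]; positivity
    rw [padicNorm.mul, padicNorm.mul]
    have hH := padicNorm_harmAlt2_le (p := p) (m := (2 * k - (26 * (n : ℤ) + 2)).toNat) (by omega)
    have hAk := padicNorm_coefAT_le (p := p) hn (by omega) (by omega : k ≤ 24 * (n : ℤ) + 1)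
    calc padicNorm p 2 * padicNorm p (coefAT (aT n) (bT n) k) * padicNorm p (harmAlt2 (2 * k - (26 * (n : ℤ) + 2)).toNat)
        ≤ 1 * (p : ℚ) ^ (-EZ p n k) * (p : ℚ) ^ (2 : ℤ) :=
          mul_le_mul (mul_le_mul two_le hAk (padicNorm.nonneg _) zero_le_one) hH (padicNorm.nonneg _) (by positivity)
      _ = (p : ℚ) ^ (2 - EZ p n k) := by rw [one_mul, ← zpow_add₀ hp0]; congr 1; ring
      _ ≤ (p : ℚ) ^ (2 - e) := zpow_le_zpow_right₀ hp1 (by linarith [he k (by omega) (by omega)])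
  -- the B-part
  have hB : ∀ k ∈ Ico (13 * (n : ℤ) + 1) (26 * (n : ℤ) + 2),
      padicNorm p (coefBT (aT n) (bT n) k * harmAlt1 (2 * k - (26 * (n : ℤ) + 2)).toNat) ≤ (p : ℚ) ^ (2 - e) := by
    intro k hk
    rw [mem_Ico] at hk
    rw [padicNorm.mul]
    have hH := padicNorm_harmAlt1_le (p := p) (m := (2 * k - (26 * (n : ℤ) + 2)).toNat) (by omega)
    have hBk := padicNorm_coefBT_le (p := p) hn hp2 hk.1 (by omega)
    calc padicNorm p (coefBT (aT n) (bT n) k) * padicNorm p (harmAlt1 (2 * k - (26 * (n : ℤ) + 2)).toNat)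
        ≤ (p : ℚ) ^ (1 - EZ p n k) * (p : ℚ) ^ (1 : ℤ) := mul_le_mul hBk hH (padicNorm.nonneg _) (by positivity)
      _ = (p : ℚ) ^ (2 - EZ p n k) := by rw [← zpow_add₀ hp0]; congr 1; ring
      _ ≤ (p : ℚ) ^ (2 - e) := zpow_le_zpow_right₀ hp1 (by linarith [he k (by omega) (by omega)])
  exact (padicNorm.nonarchimedean).trans
    (max_le (padicNorm.sum_le' hA (by positivity)) (padicNorm.sum_le' hB (by positivity)))

/-- **Bridge to the first tale's denominator-cleared form.** With the two-tale coincidence `p_n = −p̂_n`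
((bmiss)@P15 — an INPUT) and a prime `p ≤ 15n` with `26n < p²`: if `e ≤ E(k)` on the `p̂`-range then
`p^e ∣ D₁₅ₙ D₁₆ₙ p_n = pP15num n`. -/
theorem dvd_pP15num_of_bmiss (hn : 1 ≤ n) (hp2 : 26 * n < p ^ 2) (hp15 : p ≤ 15 * n)
    (hbmiss : formP (aP15 n) (bP15 n) = -formPT (aT n) (bT n)) {e : ℕ}
    (he : ∀ k : ℤ, 13 * (n : ℤ) + 1 ≤ k → k ≤ 26 * (n : ℤ) + 1 → (e : ℤ) ≤ EZ p n k) :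
    (p : ℤ) ^ e ∣ pP15num n := by
  have hp0 : (p : ℚ) ≠ 0 := by exact_mod_cast hp.out.ne_zero
  have hcast := pP15num_cast hn
  rw [hbmiss] at hcast
  have hD : ∀ m : ℕ, p ≤ m → padicNorm p ((Nat.lcmUpto m : ℕ) : ℚ) ≤ (p : ℚ) ^ (-(1 : ℤ)) := by
    intro m hm
    have hdvd : ((p ^ 1 : ℕ) : ℤ) ∣ ((Nat.lcmUpto m : ℕ) : ℤ) := by
      rw [pow_one]; exact_mod_cast OddZeta.dvd_lcmUpto hp.out.one_lt.le hm
    have := (padicNorm.dvd_iff_norm_le (p := p)).1 hdvd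
    simpa using this
  have hnorm : padicNorm p ((pP15num n : ℤ) : ℚ) ≤ (p : ℚ) ^ (-(e : ℤ)) := by
    rw [hcast, padicNorm.mul, padicNorm.mul, padicNorm.neg]
    have h3 := padicNorm_formPT_le (p := p) hn hp2 (e := e) he
    calc padicNorm p ((Nat.lcmUpto (15 * n) : ℕ) : ℚ) * padicNorm p ((Nat.lcmUpto (16 * n) : ℕ) : ℚ)
          * padicNorm p (formPT (aT n) (bT n))
        ≤ (p : ℚ) ^ (-(1 : ℤ)) * (p : ℚ) ^ (-(1 : ℤ)) * (p : ℚ) ^ (2 - (e : ℤ)) :=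
          mul_le_mul (mul_le_mul (hD _ hp15) (hD _ (by omega)) (padicNorm.nonneg _) (by positivity)) h3
            (padicNorm.nonneg _) (by positivity)
      _ = (p : ℚ) ^ (-(e : ℤ)) := by rw [← zpow_add₀ hp0, ← zpow_add₀ hp0]; congr 1; ring
  exact_mod_cast (padicNorm.dvd_iff_norm_le (p := p) (n := e) (z := pP15num n)).2 hnorm

end Assembly
end Summit.KontsevichZagierPeriods.Zeta5Search.TwoTaleP15

end
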